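import Literature.Geometry.Symplectic.NearSymplecticForms
import HarnessLib

/-!
# Zero circles of a near-symplectic form and their parity (Perutz 2006, §2.3 and Prop. 2.2)

Topic `Literature/Geometry/Symplectic` (vocabulary of the printed proof behind the named fact
`Literature.Geometry.Symplectic.relNearSymplecticTaubesTubes_exists`; definitions + proved API,
no named facts).

## The printed notions

Let `ω` be near-symplectic on the oriented `4`-manifold `X`, `Z = Z_ω` its zero set (a
`1`-manifold, Perutz 2006 Lemma 1.2) and `z ∈ Z` with oriented unit tangent `τ`.  Perutz 2006,
§2.3 (c): the composite `N_Z → Λ⁺|_Z → N_Z^* → N_Z`, `v ↦ ∇_v ω ↦ ι(τ) ∇_v ω ↦ ♯`, is a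
self-adjoint trace-free automorphism `S_{ω,g}` of the normal bundle; equivalently the bilinear
form **`S_z(v, w) = (∇_v ω)(τ, w)`** on `T_z X` (which vanishes if `v` or `w` is tangent to `Z`)
descends to a non-degenerate symmetric form of signature `(2, 1)` on `N_z = T_z X / T_z Z`, well
defined up to the positive factor `|τ|` (a conformal class, Prop. 2.2).  Its negative eigenline
field `L⁻ ⊂ N_Z` (§2.3 (d)) splits `N_Z = L⁺ ⊕ L⁻`, and the **parity** of a component circle
`Γ ⊂ Z` is `⟨w₁(L⁻), [Γ]⟩ ∈ ℤ/2` (Prop. 2.2 and the paragraph after it): `Γ` is **even**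
(= *untwisted*, Gerig 2021 §1) iff the real line bundle `L⁻|_Γ` is orientable, i.e. trivial,
i.e. iff `L⁻|_Γ ∖ 0` — equivalently the open cone bundle of `S`-NEGATIVE vectors, onto which
`L⁻ ∖ 0` is a fibrewise deformation retract — admits a continuous section over `Γ`.

## The tree's rendering (chart level, no Riemannian metric)

* `zeroNormalForm α z τ v w := (zeroGradient α z v)(τ, w)` — `S_z` read in the preferred chart
  at `z` (`zeroGradient`, `NearSymplecticForms.lean`); PROVED: it kills `τ` on the right
  (alternation) and kernel vectors of `∇α` on the left, and it is SYMMETRIC when `dα(z) = 0` and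
  `∇_τ α = 0` (`zeroNormalForm_symm`: `0 = dα_z(τ, v, w) = −S(v, w) + S(w, v)`, via
  `mextDeriv_apply_three`, the three-term expansion of the tree's `mextDeriv` at a point in
  terms of `zeroGradient`).
* `IsMinorityVector S v` — `v` lies in the open cone of the "odd-one-out" sign of the quadratic
  form `S`: `S(v, v) ≠ 0` and the REVERSE Cauchy–Schwarz inequality `S(v,v) S(w,w) ≤ S(v,w)²`
  holds against every `w`.  For a form of signature `(2, 1)` on a `3`-space (possibly plus a
  kernel) this says exactly `S(v, v) < 0` (the `S`-orthogonal complement of `v` is then positive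
  definite), and for signature `(1, 2)` exactly `S(v, v) > 0`; so the minority cone is INTRINSIC
  — independent of the orientation and length of `τ` (`S_{−τ} = −S_τ`) — and is the cone around
  Perutz's `L⁻`.  (Model: for `S = diag(1, 1, −2)`, `∂₃` is a minority vector and `∂₁` is not:
  `isMinorityVector_untwistedNormalQuad_e3`, `not_isMinorityVector_untwistedNormalQuad_e1`.)
* `IsZeroCircle α γ` — an embedded zero circle, parametrised: `γ : ℝ → M` `2π`-periodic,
  smooth, immersive, injective modulo `2πℤ`, with image in `Z_α`.
* `IsEvenZeroCircle α γ` — Perutz's parity `0`: a zero circle admitting a continuous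
  `2π`-periodic vector field `V` along `γ` (continuity in the tangent bundle `TangentBundle`)
  with `V(θ)` a minority vector of `S_{γ(θ), γ'(θ)}` for every `θ`; by the discussion above this
  is `⟨w₁(L⁻), [Γ]⟩ = 0`, i.e. `Γ = γ(ℝ)` is even / untwisted.

## Not here

Lemma 1.2 (`Z` is a `1`-manifold), non-degeneracy and signature of `S` (§2.3 (c)–(d), which needs
the definiteness of `im ∇ω`), invariance of parity under isotopy, and the parity of the model
circles (`Θ_ev` even, `Θ_odd` odd) are not formalized in this file.

## References

* T. Perutz, *Zero-sets of near-symplectic forms*, J. Symplectic Geom. 4 (2006), §2.3 (a)–(d),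
  Prop. 2.2 and the paragraph following it [Perutz2006].
* C. Gerig, *No homotopy 4-sphere invariants using ECH=SWF*, Algebr. Geom. Topol. 21 (2021), §1
  ("untwisted and twisted" zero-circles) [Gerig2021NoHomotopySphereInvariants].
-/

noncomputable section

open scoped Manifold ContDiff Topology Real
open Set Function Bundle Literature.Geometry.Kaehler Literature.Topology.FourManifolds

namespace Literature.Geometry.Symplectic

/-- Local notation: `𝔼 n` is the model space `EuclideanSpace ℝ (Fin n)`. -/
local notation "𝔼" n:arg => EuclideanSpace ℝ (Fin n)

universe u

/-! ### `removeNth` on triples and the three-term expansion of `dα` at a point -/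

/-- `removeNth 0` on `Fin 3`. [folklore] -/
theorem removeNth_zero_fin_three {β : Type*} (v : Fin 3 → β) :
    Fin.removeNth (0 : Fin 3) v = ![v 1, v 2] := by
  funext i; fin_cases i <;> rfl

/-- `removeNth 1` on `Fin 3`. [folklore] -/
theorem removeNth_one_fin_three {β : Type*} (v : Fin 3 → β) :
    Fin.removeNth (1 : Fin 3) v = ![v 0, v 2] := by
  funext i; fin_cases i <;> rfl

/-- `removeNth 2` on `Fin 3`. [folklore] -/
theorem removeNth_two_fin_three {β : Type*} (v : Fin 3 → β) :
    Fin.removeNth (2 : Fin 3) v = ![v 0, v 1] := by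
  funext i; fin_cases i <;> rfl

/-- The alternatisation of `f : E →L (2-forms)` on a triple of vectors of `ℝ⁴`:
`Alt f (a, b, c) = f a (b, c) − f b (a, c) + f c (a, b)` (Mathlib's normalisation of
`extDeriv`). [folklore] -/
theorem alternatizeUncurryFin_apply_fin_three
    (f : (𝔼 4) →L[ℝ] ((𝔼 4) [⋀^Fin 2]→L[ℝ] ℝ)) (v : Fin 3 → 𝔼 4) :
    ContinuousAlternatingMap.alternatizeUncurryFin f v =
      f (v 0) ![v 1, v 2] - f (v 1) ![v 0, v 2] + f (v 2) ![v 0, v 1] := by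
  rw [ContinuousAlternatingMap.alternatizeUncurryFin_apply, Fin.sum_univ_three]
  simp only [Fin.val_zero, pow_zero, one_smul, Fin.val_one, pow_one, neg_smul, Fin.val_two,
    removeNth_zero_fin_three, removeNth_one_fin_three, removeNth_two_fin_three]
  norm_num
  abel

section Chart

variable {M : Type u} [TopologicalSpace M] [ChartedSpace (𝔼 4) M] [IsManifold (𝓡 4) ∞ M]

/-- **`dα` at a point in terms of the chart gradient**: the tree's `mextDeriv α z`, evaluated
on three tangent vectors at `z` (read in the preferred chart at `z`), is the alternatisation of
`zeroGradient α z` (the tree's `mextDeriv_eq_extDerivWithin`: the pull-back factor in `mextDeriv`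
is the identity at the centre of the chart; `range (𝓡 4) = univ`). [folklore] -/
theorem mextDeriv_apply_three (α : MForm (𝓡 4) M ℝ 2) (z : M) (v : Fin 3 → 𝔼 4) :
    mextDeriv α z v =
      zeroGradient α z (v 0) ![v 1, v 2] - zeroGradient α z (v 1) ![v 0, v 2] +
        zeroGradient α z (v 2) ![v 0, v 1] := by
  rw [mextDeriv_eq_extDerivWithin, ModelWithCorners.Boundaryless.range_eq_univ,
    extDerivWithin_univ, extDeriv]
  exact alternatizeUncurryFin_apply_fin_three (zeroGradient α z) v

end Chart

/-! ### Perutz's quadratic form `S_z(v, w) = (∇_v ω)(τ, w)` at a zero -/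

section NormalForm

variable {M : Type u} [TopologicalSpace M] [ChartedSpace (𝔼 4) M]

/-- **Perutz's form at a zero** (Perutz 2006, §2.3 (c)): for a `2`-form `α`, a point `z` and a
vector `τ` at `z` (the tangent of the zero set), `S_z(v, w) = (∇_v α)(τ, w)`, with `∇α` the
chart gradient `zeroGradient α z` (intrinsic at a zero of `α`).  On the normal space
`T_z X / ℝτ` of a zero circle of a near-symplectic form this is, up to the positive factor `|τ|`,
the self-adjoint trace-free automorphism `S_{ω,g}` of §2.3 (c) viewed as a bilinear form.
[cite: Perutz2006, §2.3 (c)] -/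
def zeroNormalForm (α : MForm (𝓡 4) M ℝ 2) (z : M) (τ v w : 𝔼 4) : ℝ :=
  zeroGradient α z v ![τ, w]

variable {α : MForm (𝓡 4) M ℝ 2} {z : M} {τ : 𝔼 4}

/-- Unfolding. [folklore] -/
theorem zeroNormalForm_apply (α : MForm (𝓡 4) M ℝ 2) (z : M) (τ v w : 𝔼 4) :
    zeroNormalForm α z τ v w = zeroGradient α z v ![τ, w] :=
  rfl

/-- `S_z(v, τ) = 0`: the form kills the tangent direction on the right (alternation).
[cite: Perutz2006, §2.3 (c)] -/
theorem zeroNormalForm_right_self (v : 𝔼 4) : zeroNormalForm α z τ v τ = 0 :=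
  (zeroGradient α z v).map_eq_zero_of_eq ![τ, τ] (i := 0) (j := 1) rfl zero_ne_one

/-- `S_z(τ', w) = 0` for `τ'` in the kernel of `∇α(z)` (the tangent line of the zero set): the
form kills the tangent direction on the left. [cite: Perutz2006, §2.3 (c)] -/
theorem zeroNormalForm_left_of_ker {τ' : 𝔼 4} (h : zeroGradient α z τ' = 0) (w : 𝔼 4) :
    zeroNormalForm α z τ τ' w = 0 := by
  rw [zeroNormalForm_apply, h]; rfl

/-- `S_z` is additive in its first argument. [folklore] -/
theorem zeroNormalForm_add_left (v v' w : 𝔼 4) :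
    zeroNormalForm α z τ (v + v') w = zeroNormalForm α z τ v w + zeroNormalForm α z τ v' w := by
  simp only [zeroNormalForm_apply, map_add]; rfl

/-- `S_z` is homogeneous in its first argument. [folklore] -/
theorem zeroNormalForm_smul_left (c : ℝ) (v w : 𝔼 4) :
    zeroNormalForm α z τ (c • v) w = c * zeroNormalForm α z τ v w := by
  simp only [zeroNormalForm_apply, map_smul]; rfl

end NormalForm

section Symm

variable {M : Type u} [TopologicalSpace M] [ChartedSpace (𝔼 4) M] [IsManifold (𝓡 4) ∞ M]
  {α : MForm (𝓡 4) M ℝ 2} {z : M} {τ : 𝔼 4}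

/-- **`S_z` is symmetric** (Perutz 2006, §2.3 (c)–(d): `S_{ω,g}` is self-adjoint): if
`dα = 0` at `z` and `τ` is in the kernel of `∇α(z)` then
`0 = dα_z(τ, v, w) = (∇_τ α)(v, w) − (∇_v α)(τ, w) + (∇_w α)(τ, v) = −S(v, w) + S(w, v)`.
[cite: Perutz2006, §2.3 (c)] -/
theorem zeroNormalForm_symm (hd : mextDeriv α z = 0) (hτ : zeroGradient α z τ = 0) (v w : 𝔼 4) :
    zeroNormalForm α z τ v w = zeroNormalForm α z τ w v := by
  have h3 := mextDeriv_apply_three α z ![τ, v, w]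
  have e0 : (![τ, v, w] : Fin 3 → 𝔼 4) 0 = τ := rfl
  have e1 : (![τ, v, w] : Fin 3 → 𝔼 4) 1 = v := rfl
  have e2 : (![τ, v, w] : Fin 3 → 𝔼 4) 2 = w := rfl
  rw [e0, e1, e2, hτ, hd] at h3
  change (0 : ℝ) = 0 - zeroNormalForm α z τ v w + zeroNormalForm α z τ w v at h3
  linarith

/-- For a CLOSED form, `S_z` is symmetric at every point, for every kernel vector `τ`.
[cite: Perutz2006, §2.3 (c)] -/
theorem IsClosedForm.zeroNormalForm_symm (hc : IsClosedForm α) (hτ : zeroGradient α z τ = 0)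
    (v w : 𝔼 4) : zeroNormalForm α z τ v w = zeroNormalForm α z τ w v :=
  Literature.Geometry.Symplectic.zeroNormalForm_symm (congrFun hc z) hτ v w

end Symm

/-! ### Minority vectors of a quadratic form -/

/-- **Minority vectors.**  `v` lies in the open cone of the "odd-one-out" sign of the quadratic
form of `S : V × V → ℝ`: `S(v, v) ≠ 0` and the reverse Cauchy–Schwarz inequality
`S(v, v) S(w, w) ≤ S(v, w)²` holds for all `w`.  For `S` symmetric of signature `(2, 1)` on a
`3`-space (plus a possible kernel) this is `S(v, v) < 0`, for signature `(1, 2)` it is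
`S(v, v) > 0`: the `S`-orthogonal complement of such a `v` is definite of the opposite sign.
These are the non-zero vectors of the cone around Perutz's eigenline `L⁻` of `S_{ω,g}`
(Perutz 2006, §2.3 (d)), described without a metric. [cite: Perutz2006, §2.3 (d)] -/
def IsMinorityVector (S : (𝔼 4) → (𝔼 4) → ℝ) (v : 𝔼 4) : Prop :=
  S v v ≠ 0 ∧ ∀ w : 𝔼 4, S v v * S w w ≤ S v w ^ 2

/-- A minority vector is non-isotropic. [folklore] -/
theorem IsMinorityVector.ne_zero {S : (𝔼 4) → (𝔼 4) → ℝ} {v : 𝔼 4} (h : IsMinorityVector S v) :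
    S v v ≠ 0 :=
  h.1

/-- The reverse Cauchy–Schwarz inequality of a minority vector. [folklore] -/
theorem IsMinorityVector.mul_le_sq {S : (𝔼 4) → (𝔼 4) → ℝ} {v : 𝔼 4} (h : IsMinorityVector S v)
    (w : 𝔼 4) : S v v * S w w ≤ S v w ^ 2 :=
  h.2 w

/-- **The untwisted normal quadratic form** `diag(1, 1, −2)` on the normal coordinates
`(x₁, x₂, x₃) = (q 1, q 2, q 3)` of `ℝ_θ × ℝ³` (kernel `ℝ ∂_θ`): Perutz's `S` along the zero
circle of the untwisted model `Θ = x₁β₁ + x₂β₂ − 2x₃β₃` (Perutz 2006, §2.3 with §2 eq. (2)).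
[cite: Perutz2006, §2.3 (d)] -/
def untwistedNormalQuad (v w : 𝔼 4) : ℝ :=
  v 1 * w 1 + v 2 * w 2 - 2 * (v 3 * w 3)

/-- **`∂₃` is a minority vector of `diag(1, 1, −2)`** (the negative eigenline `L⁻` of the
untwisted model is the constant line `ℝ ∂₃`). [cite: Perutz2006, §2.3 (d)] -/
theorem isMinorityVector_untwistedNormalQuad_e3 :
    IsMinorityVector untwistedNormalQuad (EuclideanSpace.single 3 1) := by
  refine ⟨by simp [untwistedNormalQuad], fun w => ?_⟩
  simp [untwistedNormalQuad]
  nlinarith [sq_nonneg (w 1), sq_nonneg (w 2)]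

/-- **`∂₁` is NOT a minority vector of `diag(1, 1, −2)`** (it lies in the majority cone: against
`w = ∂₂` the reverse Cauchy–Schwarz inequality fails). [folklore] -/
theorem not_isMinorityVector_untwistedNormalQuad_e1 :
    ¬ IsMinorityVector untwistedNormalQuad (EuclideanSpace.single 1 1) := by
  rintro ⟨-, h⟩
  have := h (EuclideanSpace.single 2 1)
  simp [untwistedNormalQuad] at this
  linarith

/-! ### Zero circles and their parity -/

section Circle

variable {M : Type u} [TopologicalSpace M] [ChartedSpace (𝔼 4) M]

/-- **An (embedded, parametrised) zero circle of `α`**: a `2π`-periodic smooth immersion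
`γ : ℝ → M`, injective modulo `2πℤ` (an embedding of `ℝ/2πℤ`), with image in the zero locus
`Z_α` (Perutz 2006, Lemma 1.2: the zero set is a `1`-manifold; a "component-circle `Γ` of
`Z_ω`", Prop. 2.2). [cite: Perutz2006, Lemma 1.2 and Prop. 2.2] -/
structure IsZeroCircle (α : MForm (𝓡 4) M ℝ 2) (γ : ℝ → M) : Prop where
  /-- `γ` is `2π`-periodic. -/
  periodic : ∀ θ : ℝ, γ (θ + 2 * π) = γ θ
  /-- `γ` is smooth. -/
  contMDiff : ContMDiff 𝓘(ℝ, ℝ) (𝓡 4) ∞ γ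
  /-- `γ` is an immersion. -/
  injective_mfderiv : ∀ θ : ℝ, Function.Injective (mfderiv 𝓘(ℝ, ℝ) (𝓡 4) γ θ)
  /-- `γ` is injective modulo the period lattice `2πℤ`. -/
  eq_add_of_eq : ∀ θ θ' : ℝ, γ θ' = γ θ → ∃ k : ℤ, θ' = θ + 2 * π * k
  /-- `γ` runs in the zero locus of `α`. -/
  mem_zeroLocus : ∀ θ : ℝ, γ θ ∈ zeroLocus α

/-- The tangent vector `γ'(θ) ∈ T_{γ θ} M` (read in the preferred chart at `γ θ`). [folklore] -/
def zeroCircleTangent (γ : ℝ → M) (θ : ℝ) : 𝔼 4 :=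
  mfderiv 𝓘(ℝ, ℝ) (𝓡 4) γ θ 1

/-- The tangent vector of a zero circle is non-zero. [folklore] -/
theorem IsZeroCircle.zeroCircleTangent_ne_zero {α : MForm (𝓡 4) M ℝ 2} {γ : ℝ → M}
    (h : IsZeroCircle α γ) (θ : ℝ) : zeroCircleTangent γ θ ≠ 0 := by
  intro h0
  have hinj := h.injective_mfderiv θ
  have h1 : mfderiv 𝓘(ℝ, ℝ) (𝓡 4) γ θ (1 : ℝ) = 0 := h0
  have h2 : mfderiv 𝓘(ℝ, ℝ) (𝓡 4) γ θ (0 : ℝ) = 0 := (mfderiv 𝓘(ℝ, ℝ) (𝓡 4) γ θ).map_zero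
  have h3 : (1 : ℝ) = 0 := hinj (h1.trans h2.symm)
  exact one_ne_zero h3

/-- `α` vanishes along a zero circle. [folklore] -/
theorem IsZeroCircle.apply_eq_zero {α : MForm (𝓡 4) M ℝ 2} {γ : ℝ → M} (h : IsZeroCircle α γ)
    (θ : ℝ) : α (γ θ) = 0 :=
  h.mem_zeroLocus θ

/-- Periodicity of a zero circle under the whole lattice `2πℤ`. [folklore] -/
theorem IsZeroCircle.periodic_int {α : MForm (𝓡 4) M ℝ 2} {γ : ℝ → M} (h : IsZeroCircle α γ)
    (θ : ℝ) (k : ℤ) : γ (θ + 2 * π * k) = γ θ := by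
  induction k using Int.induction_on generalizing θ with
  | zero => simp
  | succ n ih =>
    have := h.periodic (θ + 2 * π * (n : ℤ))
    push_cast at this ih ⊢
    rw [show θ + 2 * π * (n + 1 : ℝ) = θ + 2 * π * n + 2 * π by ring, this, ih]
  | pred n ih =>
    have := h.periodic (θ + 2 * π * ((-(n : ℤ) - 1 : ℤ) : ℝ))
    push_cast at this ih ⊢
    rw [show θ + 2 * π * (-(n : ℝ) - 1) + 2 * π = θ + 2 * π * (-n) by ring] at this
    rw [← this, ih]

end Circle

section Parity

variable {M : Type u} [TopologicalSpace M] [ChartedSpace (𝔼 4) M] [IsManifold (𝓡 4) ∞ M]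

/-- **Even (= untwisted) zero circles** (Perutz 2006, Prop. 2.2 and the paragraph after it;
Gerig 2021, §1): a zero circle `γ` of `α` along which there is a continuous `2π`-periodic vector
field `V` (continuity in the tangent bundle of `M`) such that `V(θ)` is a minority vector of
Perutz's form `S_{γ(θ), γ'(θ)}` for every `θ`.  Since the minority cone bundle along `Γ = γ(ℝ)`
deformation-retracts fibrewise onto `L⁻ ∖ 0`, such a `V` exists iff the real line bundle
`L⁻|_Γ` is trivial, i.e. iff `⟨w₁(L⁻), [Γ]⟩ = 0`: parity `0` in Perutz's sense.
[cite: Perutz2006, Prop. 2.2] -/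
def IsEvenZeroCircle (α : MForm (𝓡 4) M ℝ 2) (γ : ℝ → M) : Prop :=
  IsZeroCircle α γ ∧
    ∃ V : ℝ → 𝔼 4, (∀ θ : ℝ, V (θ + 2 * π) = V θ) ∧
      Continuous (fun θ : ℝ => (TotalSpace.mk' (𝔼 4) (γ θ) (V θ) : TangentBundle (𝓡 4) M)) ∧
      ∀ θ : ℝ, IsMinorityVector (zeroNormalForm α (γ θ) (zeroCircleTangent γ θ)) (V θ)

/-- An even zero circle is a zero circle. [folklore] -/
theorem IsEvenZeroCircle.isZeroCircle {α : MForm (𝓡 4) M ℝ 2} {γ : ℝ → M}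
    (h : IsEvenZeroCircle α γ) : IsZeroCircle α γ :=
  h.1

/-- The witnessing vector field of an even zero circle. [folklore] -/
theorem IsEvenZeroCircle.exists_section {α : MForm (𝓡 4) M ℝ 2} {γ : ℝ → M}
    (h : IsEvenZeroCircle α γ) :
    ∃ V : ℝ → 𝔼 4, (∀ θ : ℝ, V (θ + 2 * π) = V θ) ∧
      Continuous (fun θ : ℝ => (TotalSpace.mk' (𝔼 4) (γ θ) (V θ) : TangentBundle (𝓡 4) M)) ∧
      ∀ θ : ℝ, IsMinorityVector (zeroNormalForm α (γ θ) (zeroCircleTangent γ θ)) (V θ) :=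
  h.2

/-- **Odd (= twisted) zero circles**: zero circles that are not even (parity `1`,
`⟨w₁(L⁻), [Γ]⟩ ≠ 0`; Perutz 2006, Prop. 2.2; Gerig 2021, §1). [cite: Perutz2006, Prop. 2.2] -/
def IsOddZeroCircle (α : MForm (𝓡 4) M ℝ 2) (γ : ℝ → M) : Prop :=
  IsZeroCircle α γ ∧ ¬ IsEvenZeroCircle α γ

/-- A zero circle is even or odd. [folklore] -/
theorem IsZeroCircle.isEvenZeroCircle_or_isOddZeroCircle {α : MForm (𝓡 4) M ℝ 2} {γ : ℝ → M}
    (h : IsZeroCircle α γ) : IsEvenZeroCircle α γ ∨ IsOddZeroCircle α γ := by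
  by_cases he : IsEvenZeroCircle α γ
  · exact Or.inl he
  · exact Or.inr ⟨h, he⟩

end Parity

end Literature.Geometry.Symplectic

end
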